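import Summits.Ventures.PercRepro.C025Profile
import Summits.Ventures.PercRepro.RankLevelSetB

/-!
# PercRepro — C-032 PROFILE (Π): the first proved cases of the row (night-3, gen 6)

Companion of `C025Profile.lean` (the statements `C025Profile` / `ProfileHall` and their bridges). Two cases of
`(Π_{q,u})`: `#{S : ρ(S) = u} ≥ Σ_{B : ρ(B) = q, ρ(E∖B) ≥ u} C(ρ(B)+ρ(E∖B), u)/C(ρ(B)+ρ(E∖B), q)` are kernel theorems here:

* **`profileIneq_of_girth`** — `(Π_{q,u})` for every matroid of girth `≥ u + 1` (every subset with `≤ u` elements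
  independent) and every `q < u`, the analogue of Theorem G′ (NIGHT3-G6-PROFILE.md §7(b)): the `u`-subsets are rank-`u`
  sets (`choose_le_card_levelSet`), the rank-`q` sets are `q`-subsets (`Rq_subset_powersetCard`), and every price is
  `≤ C(|E|,u)/C(|E|,q)` because `C(m,u)/C(m,q)` is increasing in `m` (`Profile.choose_ratio_mono`, from
  `Nat.choose_mul_succ_eq`) and `ρ(E ∖ B) ≤ |E| − q` (`price_le_of_girth`);
* **`profileIneq_one_of_simple_coloopFree`** — `(Π_{1,u})` for every simple coloop-free matroid and every `u ≥ 1`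
  (§7(e), §8): the rank-`1` sets are the points (`Rq_one_eq_image_singleton`, via `eq_singleton_of_eRk_one_of_simple`),
  every point has price `C(R+1,u)/(R+1)` with `R = ρ(E)` (`price_singleton_of_not_isColoop`,
  `eRk_ground_diff_singleton_of_not_isColoop`), and the inequality is the cell's level-wise Theorem B′
  `c025_levelwise_q_one_of_simple` (RankLevelSetB) at `p = R` with `n_{R,1} ≥ |E|` (`card_ground_le_ncard_top_one`).
  Paper: coloops by the tree's coloop convolution + two binomial inequalities, parallel classes by Theorem D's
  coefficient argument — so `(Π_{1,u})` holds for EVERY finite matroid; only the simple coloop-free case is typed.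
-/

open scoped Matroid

namespace PercRepro

open Set Finset ThmH

namespace Profile

/-- `C(m,u)·C(m+1,q) ≤ C(m+1,u)·C(m,q)` for `q ≤ u ≤ m` (Pascal-type rearrangement in `ℕ`). -/
theorem choose_mul_choose_succ_le {m q u : ℕ} (hqu : q ≤ u) (hum : u ≤ m) :
    Nat.choose m u * Nat.choose (m + 1) q ≤ Nat.choose (m + 1) u * Nat.choose m q := by
  have hu := Nat.choose_mul_succ_eq m u
  have hq := Nat.choose_mul_succ_eq m q
  have hle : m + 1 - u ≤ m + 1 - q := by omega
  have key : Nat.choose m u * Nat.choose (m + 1) q * (m + 1) ≤ Nat.choose (m + 1) u * Nat.choose m q * (m + 1) := by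
    calc Nat.choose m u * Nat.choose (m + 1) q * (m + 1)
        = (Nat.choose m u * (m + 1)) * Nat.choose (m + 1) q := by ring
      _ = Nat.choose (m + 1) u * (m + 1 - u) * Nat.choose (m + 1) q := by rw [hu]
      _ ≤ Nat.choose (m + 1) u * (m + 1 - q) * Nat.choose (m + 1) q := by
          apply Nat.mul_le_mul_right
          exact Nat.mul_le_mul_left _ hle
      _ = Nat.choose (m + 1) u * (Nat.choose m q * (m + 1)) := by rw [hq]; ring
      _ = Nat.choose (m + 1) u * Nat.choose m q * (m + 1) := by ring
  exact Nat.le_of_mul_le_mul_right key (Nat.succ_pos m)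

/-- `C(m,u)/C(m,q) ≤ C(m+1,u)/C(m+1,q)` for `q ≤ u ≤ m`: the profile price is increasing in `m`. -/
theorem choose_ratio_le_succ {m q u : ℕ} (hqu : q ≤ u) (hum : u ≤ m) :
    (Nat.choose m u : ℚ) / (Nat.choose m q : ℚ) ≤ (Nat.choose (m + 1) u : ℚ) / (Nat.choose (m + 1) q : ℚ) := by
  have hq : (0 : ℚ) < Nat.choose m q := by exact_mod_cast Nat.choose_pos (by omega)
  have hq' : (0 : ℚ) < Nat.choose (m + 1) q := by exact_mod_cast Nat.choose_pos (by omega)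
  rw [div_le_div_iff₀ hq hq']
  exact_mod_cast choose_mul_choose_succ_le hqu hum

/-- `C(m,u)/C(m,q) ≤ C(n,u)/C(n,q)` for `q ≤ u ≤ m ≤ n`. -/
theorem choose_ratio_mono {m n q u : ℕ} (hqu : q ≤ u) (hum : u ≤ m) (hmn : m ≤ n) :
    (Nat.choose m u : ℚ) / (Nat.choose m q : ℚ) ≤ (Nat.choose n u : ℚ) / (Nat.choose n q : ℚ) := by
  induction n, hmn using Nat.le_induction with
  | base => exact le_rfl
  | succ k hmk ih => exact ih.trans (choose_ratio_le_succ hqu (hum.trans hmk))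

end Profile

section Girth

variable {α : Type*} [DecidableEq α] {M : Matroid α} [M.Finite]

omit [DecidableEq α] in
/-- If every subset of `E` with at most `u` elements is independent, every `u`-subset of `gr M` lies in `Shadow.levelSet M u`. -/
theorem powersetCard_subset_levelSet {u : ℕ} (hg : ∀ T ⊆ M.E, T.encard ≤ u → M.Indep T) :
    Finset.powersetCard u (gr M) ⊆ Shadow.levelSet M u := by
  intro S hS
  rw [Finset.mem_powersetCard] at hS
  rw [Profile.mem_levelSet]
  refine ⟨hS.1, ?_⟩
  have hSE : (S : Set α) ⊆ M.E := by rw [← coe_gr]; exact_mod_cast hS.1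
  have henc : (S : Set α).encard = (u : ℕ∞) := by rw [Set.encard_coe_eq_coe_finsetCard, hS.2]
  have hind : M.Indep (S : Set α) := hg _ hSE henc.le
  rw [hind.eRk_eq_encard, henc]

omit [DecidableEq α] in
/-- Under the girth hypothesis, `C(|E|, u) ≤ #Lq(u)`. -/
theorem choose_le_card_levelSet {u : ℕ} (hg : ∀ T ⊆ M.E, T.encard ≤ u → M.Indep T) :
    Nat.choose (gr M).card u ≤ (Shadow.levelSet M u).card := by
  rw [← Finset.card_powersetCard]
  exact Finset.card_le_card (powersetCard_subset_levelSet hg)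

omit [DecidableEq α] in
/-- Under the girth hypothesis (with `q < u`), every rank-`q` set is a `q`-subset of the ground set. -/
theorem Rq_subset_powersetCard {q u : ℕ} (hg : ∀ T ⊆ M.E, T.encard ≤ u → M.Indep T) (hqu : q < u) :
    Profile.Rq M q ⊆ Finset.powersetCard q (gr M) := by
  intro B hB
  rw [Profile.mem_Rq] at hB
  rw [Finset.mem_powersetCard]
  refine ⟨hB.1, ?_⟩
  have hBE : (B : Set α) ⊆ M.E := by rw [← coe_gr]; exact_mod_cast hB.1
  rcases lt_trichotomy B.card q with hlt | heq | hgt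
  · exfalso
    have h1 : M.eRk (B : Set α) ≤ (B : Set α).encard := M.eRk_le_encard _
    rw [hB.2, Set.encard_coe_eq_coe_finsetCard] at h1
    have : q ≤ B.card := by exact_mod_cast h1
    omega
  · exact heq
  · exfalso
    obtain ⟨T, hTB, hTc⟩ := Finset.exists_subset_card_eq (show q + 1 ≤ B.card by omega)
    have hTE : (T : Set α) ⊆ M.E := (Finset.coe_subset.2 hTB).trans hBE
    have henc : (T : Set α).encard = ((q + 1 : ℕ) : ℕ∞) := by rw [Set.encard_coe_eq_coe_finsetCard, hTc]
    have hind : M.Indep (T : Set α) := hg _ hTE (by rw [henc]; exact_mod_cast hqu)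
    have h1 : M.eRk (T : Set α) ≤ M.eRk (B : Set α) := M.eRk_mono (Finset.coe_subset.2 hTB)
    rw [hind.eRk_eq_encard, henc, hB.2] at h1
    have : q + 1 ≤ q := by exact_mod_cast h1
    omega

/-- Under the girth hypothesis every rank-`q` set has price at most `C(|E|,u)/C(|E|,q)`. -/
theorem price_le_of_girth {q u : ℕ} (hg : ∀ T ⊆ M.E, T.encard ≤ u → M.Indep T) (hqu : q < u)
    {B : Finset α} (hB : B ∈ Profile.Rq M q) :
    Profile.price M q u B ≤ (Nat.choose (gr M).card u : ℚ) / (Nat.choose (gr M).card q : ℚ) := by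
  have hBc : B.card = q := (Finset.mem_powersetCard.1 (Rq_subset_powersetCard hg hqu hB)).2
  have hBg : B ⊆ gr M := (Profile.mem_Rq.1 hB).1
  unfold Profile.price
  split_ifs with hu
  · -- p' := toNat (eRk (gr ∖ B)) ≤ |gr ∖ B| = n − q
    set p' := (M.eRk ((gr M \ B : Finset α) : Set α)).toNat with hp'
    have hfin : M.eRk ((gr M \ B : Finset α) : Set α) ≠ ⊤ := by
      have := M.eRk_le_encard ((gr M \ B : Finset α) : Set α)
      rw [Set.encard_coe_eq_coe_finsetCard] at this
      exact ne_top_of_le_ne_top (ENat.coe_ne_top _) this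
    have hp'le : p' ≤ (gr M \ B).card := by
      have := M.eRk_le_encard ((gr M \ B : Finset α) : Set α)
      rw [Set.encard_coe_eq_coe_finsetCard, ← ENat.coe_toNat hfin] at this
      exact_mod_cast this
    have hcard : (gr M \ B).card = (gr M).card - q := by rw [Finset.card_sdiff_of_subset hBg, hBc]
    have hqn : q ≤ (gr M).card := hBc ▸ Finset.card_le_card hBg
    have hup' : u ≤ p' := by
      rw [← ENat.coe_toNat hfin] at hu
      exact_mod_cast hu
    exact Profile.choose_ratio_mono hqu.le (by omega) (by omega)
  · exact div_nonneg (Nat.cast_nonneg _) (Nat.cast_nonneg _)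

/-- **(Π_{q,u}) for every matroid of girth `≥ u + 1`** (every subset with at most `u` elements independent), every `q < u`
— the analogue of Theorem G′ (NIGHT3-G6-PROFILE.md §7(b)). -/
theorem profileIneq_of_girth {q u : ℕ} (hg : ∀ T ⊆ M.E, T.encard ≤ u → M.Indep T) (hqu : q < u) :
    Profile.ProfileIneq M q u := by
  unfold Profile.ProfileIneq
  set n := (gr M).card with hn
  have hRq : (Profile.Rq M q).card ≤ Nat.choose n q := by
    rw [← Finset.card_powersetCard]
    exact Finset.card_le_card (Rq_subset_powersetCard hg hqu)
  calc ∑ B ∈ Profile.Rq M q, Profile.price M q u B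
      ≤ ∑ _B ∈ Profile.Rq M q, (Nat.choose n u : ℚ) / (Nat.choose n q : ℚ) :=
        Finset.sum_le_sum (fun B hB => price_le_of_girth hg hqu hB)
    _ = ((Profile.Rq M q).card : ℚ) * ((Nat.choose n u : ℚ) / (Nat.choose n q : ℚ)) := by
        rw [Finset.sum_const, nsmul_eq_mul]
    _ ≤ (Nat.choose n q : ℚ) * ((Nat.choose n u : ℚ) / (Nat.choose n q : ℚ)) := by
        apply mul_le_mul_of_nonneg_right _ (div_nonneg (Nat.cast_nonneg _) (Nat.cast_nonneg _))
        exact_mod_cast hRq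
    _ ≤ (Nat.choose n u : ℚ) := by
        by_cases hz : (Nat.choose n q : ℚ) = 0
        · rw [hz, zero_mul]; exact Nat.cast_nonneg _
        · rw [mul_div_cancel₀ _ hz]
    _ ≤ ((Shadow.levelSet M u).card : ℚ) := by exact_mod_cast choose_le_card_levelSet hg

end Girth

section ProfileOne

variable {α : Type} {M : Matroid α}

/-- In a simple matroid (every `≤ 2`-subset independent), a subset of the ground set of rank `1` is a singleton. -/
theorem eq_singleton_of_eRk_one_of_simple (hsimple : ∀ T ⊆ M.E, T.encard ≤ 2 → M.Indep T)
    {X : Set α} (hX : X ⊆ M.E) (h1 : M.eRk X = 1) : ∃ e ∈ M.E, X = {e} := by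
  obtain ⟨e, heX, -, hXe⟩ := (M.eRk_eq_one_iff hX).1 h1
  refine ⟨e, hX heX, ?_⟩
  ext f
  constructor
  · intro hf
    by_contra hfe
    have hind : M.Indep {e, f} := by
      refine hsimple _ (by simp only [Set.insert_subset_iff, Set.singleton_subset_iff]; exact ⟨hX heX, hX hf⟩) ?_
      calc ({e, f} : Set α).encard ≤ ({e} : Set α).encard + ({f} : Set α).encard := by
            rw [Set.insert_eq]; exact Set.encard_union_le _ _
        _ = 2 := by simp only [Set.encard_singleton]; rfl
    have hmem : f ∈ M.closure ({e, f} \ {f}) := by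
      have : ({e, f} : Set α) \ {f} = {e} := by
        ext x; simp only [Set.mem_sdiff, Set.mem_insert_iff, Set.mem_singleton_iff]
        constructor
        · rintro ⟨h | h, h2⟩
          · exact h
          · exact absurd h h2
        · intro h; exact ⟨Or.inl h, by rw [h]; exact Ne.symm hfe⟩
      rw [this]; exact hXe hf
    exact hind.notMem_closure_sdiff_of_mem (by simp) hmem
  · intro hf
    rw [Set.mem_singleton_iff] at hf
    rw [hf]; exact heX

/-- For a non-coloop `x`, `E ∖ {x}` is spanning, so `ρ(E ∖ {x}) = ρ(E)`. -/
theorem eRk_ground_diff_singleton_of_not_isColoop {x : α} (hcol : ¬ M.IsColoop x) :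
    M.eRk (M.E \ {x}) = M.eRank := by
  have hsp : M.Spanning (M.E \ {x}) := by
    by_contra h
    exact hcol (M.isColoop_iff_sdiff_not_spanning.2 h)
  exact hsp.eRk_eq

variable [DecidableEq α] [M.Finite]

/-- In a simple matroid the rank-`1` sets are exactly the singletons of the ground set. -/
theorem Rq_one_eq_image_singleton (hsimple : ∀ T ⊆ M.E, T.encard ≤ 2 → M.Indep T) :
    Profile.Rq M 1 = (gr M).image (fun x => ({x} : Finset α)) := by
  ext B
  rw [Profile.mem_Rq, Finset.mem_image]
  constructor
  · rintro ⟨hB, h1⟩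
    have hBE : (B : Set α) ⊆ M.E := by rw [← coe_gr]; exact_mod_cast hB
    obtain ⟨e, heE, he⟩ := eq_singleton_of_eRk_one_of_simple hsimple hBE (by exact_mod_cast h1)
    refine ⟨e, ?_, ?_⟩
    · rw [← Finset.mem_coe, coe_gr]; exact heE
    · apply Finset.coe_injective
      rw [he, Finset.coe_singleton]
  · rintro ⟨x, hx, rfl⟩
    refine ⟨by simpa using hx, ?_⟩
    have hxE : x ∈ M.E := by rw [← coe_gr]; exact_mod_cast hx
    have hind : M.Indep {x} := hsimple _ (by simpa using hxE) (by simp)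
    rw [Finset.coe_singleton]
    exact_mod_cast (M.eRk_singleton_eq_one_iff.2 (M.indep_singleton.1 hind))

/-- The price of a non-coloop point at level `u`, with `R := ρ(E)`: `C(R+1,u)/(R+1)` if `u ≤ R`, else `0`. -/
theorem price_singleton_of_not_isColoop (hcolfree : ∀ e, ¬ M.IsColoop e) (u : ℕ) (x : α) :
    Profile.price M 1 u ({x} : Finset α) =
      if u ≤ M.eRank.toNat then (Nat.choose (M.eRank.toNat + 1) u : ℚ) / (M.eRank.toNat + 1 : ℚ) else 0 := by
  have hcoe : ((gr M \ ({x} : Finset α) : Finset α) : Set α) = M.E \ {x} := by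
    rw [Finset.coe_sdiff, coe_gr, Finset.coe_singleton]
  have hRtop : M.eRank ≠ ⊤ := M.eRank_ne_top_iff.2 inferInstance
  have hR : M.eRk (M.E \ {x}) = (M.eRank.toNat : ℕ∞) := by
    rw [eRk_ground_diff_singleton_of_not_isColoop (hcolfree x), ENat.coe_toNat hRtop]
  unfold Profile.price
  rw [hcoe, hR, ENat.toNat_coe, Nat.choose_one_right]
  by_cases hu : u ≤ M.eRank.toNat
  · rw [if_pos (by exact_mod_cast hu), if_pos hu]; push_cast; rfl
  · rw [if_neg (by exact_mod_cast hu), if_neg hu]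

omit [DecidableEq α] in
/-- `|E| ≤ #{A ⊆ E : ρ(A) = ρ(E), ρ(E ∖ A) = 1}` for a simple coloop-free matroid (`x ↦ E ∖ {x}`). -/
theorem card_ground_le_ncard_top_one (hsimple : ∀ T ⊆ M.E, T.encard ≤ 2 → M.Indep T)
    (hcolfree : ∀ e, ¬ M.IsColoop e) :
    (gr M).card ≤ {A : Set α | A ⊆ M.E ∧ M.eRk A = (M.eRank.toNat : ℕ∞) ∧ M.eRk (M.E \ A) = ((1 : ℕ) : ℕ∞)}.ncard := by
  have hRtop : M.eRank ≠ ⊤ := M.eRank_ne_top_iff.2 inferInstance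
  have hEfin : M.E.Finite := M.ground_finite
  rw [← Set.ncard_coe_finset (gr M), coe_gr]
  refine Set.ncard_le_ncard_of_injOn (fun x => M.E \ {x}) ?_ ?_ (hEfin.finite_subsets.subset (fun A hA => hA.1))
  · intro x hx
    refine ⟨Set.sdiff_subset, ?_, ?_⟩
    · rw [eRk_ground_diff_singleton_of_not_isColoop (hcolfree x), ENat.coe_toNat hRtop]
    · rw [Set.sdiff_sdiff_cancel_left (Set.singleton_subset_iff.2 hx)]
      have hind : M.Indep {x} := hsimple _ (Set.singleton_subset_iff.2 hx) (by simp)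
      exact_mod_cast M.eRk_singleton_eq_one_iff.2 (M.indep_singleton.1 hind)
  · intro x hx y hy hxy
    simp only at hxy
    have := congrArg (fun S => M.E \ S) hxy
    simp only [Set.sdiff_sdiff_cancel_left (Set.singleton_subset_iff.2 hx),
      Set.sdiff_sdiff_cancel_left (Set.singleton_subset_iff.2 hy)] at this
    exact Set.singleton_injective this

/-- **(Π_{1,u}) for simple coloop-free matroids** = the cell's level-wise Theorem B′ at `p = ρ(E)`. -/
theorem profileIneq_one_of_simple_coloopFree (hsimple : ∀ T ⊆ M.E, T.encard ≤ 2 → M.Indep T)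
    (hcolfree : ∀ e, ¬ M.IsColoop e) (u : ℕ) (hu : 1 ≤ u) : Profile.ProfileIneq M 1 u := by
  classical
  unfold Profile.ProfileIneq
  rw [Rq_one_eq_image_singleton hsimple, Finset.sum_image (fun x _ y _ h => Finset.singleton_injective h)]
  rw [Finset.sum_congr rfl (fun x _ => price_singleton_of_not_isColoop hcolfree u x)]
  set R := M.eRank.toNat with hRdef
  by_cases huR : u ≤ R
  · simp only [if_pos huR, Finset.sum_const, nsmul_eq_mul]
    -- B′ at p = R
    have hB := c025_levelwise_q_one_of_simple (M := M) hsimple R u hu huR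
    have hLq : ((Shadow.levelSet M u).card : ℚ) = ({S : Set α | S ⊆ M.E ∧ M.eRk S = (u : ℕ∞)}.ncard : ℚ) := by
      rw [ncard_family_eq_card M (fun S => M.eRk S = (u : ℕ∞))]; rfl
    have hE := card_ground_le_ncard_top_one hsimple hcolfree
    rw [hLq]
    have hpos : (0 : ℚ) < (R : ℚ) + 1 := by positivity
    rw [mul_div_assoc', div_le_iff₀ hpos]
    have h1 : ((gr M).card : ℚ) * (Nat.choose (R + 1) u : ℚ) ≤
        ({A : Set α | A ⊆ M.E ∧ M.eRk A = (R : ℕ∞) ∧ M.eRk (M.E \ A) = ((1 : ℕ) : ℕ∞)}.ncard : ℚ) * (Nat.choose (R + 1) u : ℚ) := by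
      apply mul_le_mul_of_nonneg_right _ (Nat.cast_nonneg _)
      exact_mod_cast hE
    calc ((gr M).card : ℚ) * (Nat.choose (R + 1) u : ℚ) ≤ _ := h1
      _ ≤ ({S : Set α | S ⊆ M.E ∧ M.eRk S = (u : ℕ∞)}.ncard : ℚ) * ((R : ℚ) + 1) := by
        have hQ : (Nat.choose (R + 1) u : ℚ) *
            ({A : Set α | A ⊆ M.E ∧ M.eRk A = (R : ℕ∞) ∧ M.eRk (M.E \ A) = ((1 : ℕ) : ℕ∞)}.ncard : ℚ) ≤
            ((R : ℚ) + 1) * ({S : Set α | S ⊆ M.E ∧ M.eRk S = (u : ℕ∞)}.ncard : ℚ) := by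
          exact_mod_cast hB
        linarith [hQ]
  · simp only [if_neg huR, Finset.sum_const, nsmul_eq_mul, mul_zero]
    exact Nat.cast_nonneg _

end ProfileOne

end PercRepro
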